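import Summits.HodgeConjecture.HodgeConjecture.Theorems.VHCAbelianSchemesRoadSecondCarriedHGoodTypingDefs
import Literature.AlgebraicGeometry.HodgeTheory.AbelianVarietyEndomorphismsHOne
import HarnessLib

/-!
# Road №4 (`VHCAbelianSchemesRoad`) — THE MOVED PAIR SPANS THE WEIL PLANE: `u^* = (m ± i√d)⁶` on the Weil lines for `u = m + φ_d`, the real structure,
# and `W = ℂw₁ + ℂw'` for a rational Weil class `w₁ ≠ 0` and `u^*w' = n·w₁` (helper toward child (c3) of crux stmt-HodgeConjecture-26512,
# skeleton v3.9 `Cruxes/DiagLocalOfMarkmanPinnedForall/Lines/birth.lean` f1912d6f699b48a2)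

research route conditional on HC_CM; not a corollary; Q11.4-sentence-2 already refuted in dim ≥ 3.

THEOREMS ONLY (ring2-b03x gen 14; `--supports stmt-HodgeConjecture-26512`; fact-free, no definition, `HC_CM` nowhere). The (c3) signature
(`SecondCarriedOfOffDiagonalVanishing`, p618714 §5) says «in `W_ℚ(Y_d) ≅ K` the directions `[γ₁]`, `[γ₂] = [u^{∓6}]·[γ₁]` differ exactly when `u⁶ ∉ ℚ`,
so `{γ₁, γ₂}` spans the Weil plane» (THEOREM M (a) ×2 at `d = 4`: `W_ℚ(Y₄) = ℚγ₀ ⊕ ℚγ₁`; `dim W = 2`, Moonen–Zarhin). This file is that linear algebra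
in kernel, for every even `d ≥ 4` and every `m : ℤ` off the three degenerate directions, on the real carrier `W = weilClassesOf D.P D.ψ 3 D.d = E₊ ⊕ E₋ ⊆
H⁶((J × Ĵ)(ℂ); ℂ)` of a secant–quotient datum `D` (`u = D.weilEndo m = m·𝟙 + φ_d`):

* §1 scalars: `(m + s)(m − s) = m² + d` (`s = i√d`), `(m + εs)ᵏ ≠ 0` (`ε = ±1`), and **`(m + s)⁶ ≠ (m − s)⁶` off `m = 0`, `3m² = d`, `m² = 3d`**
  (`(m + s)⁶ − (m − s)⁶ = 4ms(3m² − d)(m² − 3d)`: the signature's three integer side conditions are exactly `u⁶ ∉ ℝ`).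
* §2 at a datum: `u^*|_W` is a bijection of `W` (`u` an isogeny, `W` `u^*`-stable and finite-dimensional); **`u^* = (m ± s)⁶` on `E_±` for ALL
  `m : ℤ`** — the eigenclass predicates of `WeilClasses` only test `ℕ`-combinations `x·𝟙 + y·φ_d`; for `m < 0` one composes with the test endomorphism
  `G = (−m)·𝟙 + φ_d`, `u ≫ G = −(m² + d)·𝟙` (`map_weilEndo_neg_eq_smul_of_test`); a NON-ZERO RATIONAL Weil class has non-zero components on both lines
  (`conj E₊ = E₋`, rational classes are real, `E₊ ⊓ E₋ = 0`); and **`mem_weilClassesOf_and_span_of_map_weilEndo_eq_smul`**: `w₁ ∈ W` rational non-zero,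
  `u^*w' = n·w₁`, `n ≠ 0` ⟹ `w' ∈ W` and every Weil class is `x·w₁ + y·w'` (`dim E_± = 1` from `H• = ⋀•H¹`, `b₁(J × Ĵ) = 12`; `w' = (n/λ₊)e₊ + (n/λ₋)e₋`,
  `λ₊ ≠ λ₋`).

Nothing here says any stub, (c3), 2m′ᵒᴴ, 26512, `HC_AV` or HC holds. References: [cite: vanGeemen1994HodgeAV, §3.6, 4.8–4.9, Lemma 5.2 (5)–(6) and proof of Thm. 6.12]
[cite: MoonenZarhin1998WeilClasses, §1 (dim_K W_K = 1)] [cite: Markman2025SecantWeil, §1.3 (p. 5) and Thm. 1.4.1 (item 4)] [cite: Deligne1982HodgeCycles, §4 (4.3)–Prop. 4.4]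
[cite: VoisinHodgeI2002, Cor. 6.12] [cite: MumfordAV1970, §1 (3) and §19] [cite: HatcherAT2002, §3.1–3.2].
-/

noncomputable section

open CategoryTheory CategoryTheory.Limits AlgebraicGeometry Topology

namespace Summit.HodgeConjecture.HodgeConjecture.Ring2.SemiregularRepresentatives

set_option linter.dupNamespace false -- the cell's namespace repeats the summit name, as in every `Ring2*` file

open Literature.AlgebraicGeometry Literature.AlgebraicGeometry.Motives Literature.AlgebraicGeometry.Motives.AbelianVariety
open Literature.AlgebraicGeometry.HodgeTheory Literature.AlgebraicGeometry.Markman2025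
open Literature.AlgebraicTopology.SingularHomology
open Summit.HodgeConjecture.HodgeConjecture.Ring2.AbelianAll (carriedClasses)

/-! ## §1 Scalars: `(m + i√d)⁶ ≠ (m − i√d)⁶` off the three degenerate directions -/

section Scalars

/-- **`(m + s)(m − s) = m² + d`** for `s = i√d`. [folklore] -/
theorem intCast_add_mul_sub_I_mul_sqrt (m : ℤ) (d : ℕ) :
    ((m : ℂ) + Complex.I * (Real.sqrt d : ℂ)) * ((m : ℂ) - Complex.I * (Real.sqrt d : ℂ)) = (m : ℂ) ^ 2 + d := by
  have hs := I_mul_sqrt_sq d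
  linear_combination (-1 : ℂ) * hs

/-- **`(m ± i√d)⁶ ≠ 0`** (`d ≥ 1`: `|m ± i√d|² = m² + d > 0`). [folklore] -/
theorem intCast_add_I_mul_sqrt_pow_ne_zero {d : ℕ} (hd : 0 < d) (m : ℤ) (ε : ℂ) (hε : ε = 1 ∨ ε = -1) (k : ℕ) :
    ((m : ℂ) + ε * (Complex.I * (Real.sqrt d : ℂ))) ^ k ≠ 0 := by
  apply pow_ne_zero
  intro h
  -- imaginary part: `ε·√d = 0`, impossible
  have him := congrArg Complex.im h
  have hsq : (0 : ℝ) < Real.sqrt d := Real.sqrt_pos.2 (by exact_mod_cast hd)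
  rcases hε with rfl | rfl <;> simp [Complex.add_im, Complex.mul_im] at him <;> linarith

/-- **THE DIRECTION MOVES: `(m + i√d)⁶ ≠ (m − i√d)⁶` iff `u⁶ ∉ ℝ`, which holds off the three degenerate directions** `m = 0`,
`3m² = d`, `m² = 3d` (`arg u ∈ (π/6)ℤ`): `(m + s)⁶ − (m − s)⁶ = 4ms(3m² − d)(m² − 3d)` for `s² = −d`. For `(m, d) = (2, 4)`:
`(2 + 2i)⁶ = −512i ≠ 512i`. [cite: Markman2025SecantWeil, §1.3 (the sixth power of η(k) on the Weil lines)]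
[cite: vanGeemen1994HodgeAV, 4.9 and Lemma 5.2] -/
theorem intCast_add_I_mul_sqrt_pow_six_ne {d : ℕ} (hd : 0 < d) {m : ℤ} (hm0 : m ≠ 0) (hm1 : 3 * m ^ 2 ≠ (d : ℤ))
    (hm2 : m ^ 2 ≠ 3 * (d : ℤ)) :
    ((m : ℂ) + Complex.I * (Real.sqrt d : ℂ)) ^ (2 * 3) ≠ ((m : ℂ) - Complex.I * (Real.sqrt d : ℂ)) ^ (2 * 3) := by
  set s : ℂ := Complex.I * (Real.sqrt d : ℂ) with hs_def
  have hs : s ^ 2 = -(d : ℂ) := I_mul_sqrt_sq d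
  have hs0 : s ≠ 0 := I_mul_sqrt_ne_zero hd
  have key : ((m : ℂ) + s) ^ (2 * 3) - ((m : ℂ) - s) ^ (2 * 3) =
      4 * (m : ℂ) * s * (3 * (m : ℂ) ^ 2 - d) * ((m : ℂ) ^ 2 - 3 * d) := by
    linear_combination (40 * (m : ℂ) ^ 3 * s + 12 * (m : ℂ) * s * (s ^ 2 - d)) * hs
  intro h
  have h0 : 4 * (m : ℂ) * s * (3 * (m : ℂ) ^ 2 - d) * ((m : ℂ) ^ 2 - 3 * d) = 0 := by rw [← key, h, sub_self]
  have hmC : (m : ℂ) ≠ 0 := Int.cast_ne_zero.2 hm0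
  have h1C : (3 * (m : ℂ) ^ 2 - d) ≠ 0 := by
    intro e
    apply hm1
    have e' : ((3 * m ^ 2 : ℤ) : ℂ) = ((d : ℤ) : ℂ) := by push_cast; exact sub_eq_zero.1 e
    exact Int.cast_injective e'
  have h2C : ((m : ℂ) ^ 2 - 3 * d) ≠ 0 := by
    intro e
    apply hm2
    have e' : ((m ^ 2 : ℤ) : ℂ) = ((3 * (d : ℤ) : ℤ) : ℂ) := by push_cast; exact sub_eq_zero.1 e
    exact Int.cast_injective e'
  exact (mul_ne_zero (mul_ne_zero (mul_ne_zero (mul_ne_zero (by norm_num) hmC) hs0) h1C) h2C) h0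

end Scalars

/-! ## §2 Weil-plane algebra at a datum: `u^*` on `W = E₊ ⊕ E₋`, the real structure, and the span of a moved pair -/

namespace SecantQuotientDatum

variable (D : SecantQuotientDatum)

/-- `0 < d`. [cite: Markman2025SecantWeil, §1.5 (p. 7)] -/
theorem d_pos' : 0 < D.d := lt_of_lt_of_le (by decide) D.four_le

/-- `φ_d ≫ φ_d = -(d • 𝟙)` in the `ℕ`-scalar spelling. [cite: Markman2025SecantWeil, §3.2] -/
theorem ψ_comp_ψ_nsmul' : D.ψ ≫ D.ψ = -(D.d • 𝟙 D.P) := by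
  rw [D.ψ_comp_ψ, natCast_zsmul]

/-- `b₁(J × Ĵ) = 12 = 2·(2·3)`. [cite: MumfordAV1970, §1 (3)] -/
theorem finrank_complexBetti_P_one : Module.finrank ℂ (complexBetti D.P.X 1) = 2 * (2 * 3) := by
  rw [AbelianVariety.finrank_complexBetti_one, D.dim_P]

/-- **`u^*` maps the Weil plane ONTO itself** (`u = m + φ_d`): `W` is `u^*`-stable (`u ∈ ℤ[φ_d]` commutes with `φ_d`), `u^*` is injective on
`H⁶(J × Ĵ)` (`u` is an isogeny) and `W` is finite-dimensional, so `u^*|_W` is a bijection of `W`.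
[cite: vanGeemen1994HodgeAV, 4.8–4.9 and §3.6] -/
theorem exists_mem_weilClassesOf_map_weilEndo_eq (m : ℤ) {v : complexBetti D.P.X (2 * 3)} (hv : v ∈ weilClassesOf D.P D.ψ 3 D.d) :
    ∃ w ∈ weilClassesOf D.P D.ψ 3 D.d, complexBetti.map (D.weilEndo m).hom.hom.hom (2 * 3) w = v := by
  haveI : Module.Finite ℂ (complexBetti D.P.X (2 * 3)) := finite_complexBetti_abelianVariety D.P (2 * 3)
  set W := weilClassesOf D.P D.ψ 3 D.d with hW_def
  set f : complexBetti D.P.X (2 * 3) →ₗ[ℂ] complexBetti D.P.X (2 * 3) := (complexBetti.map (D.weilEndo m).hom.hom.hom (2 * 3)).hom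
    with hf_def
  have hmaps : ∀ w ∈ W, f w ∈ W := fun w hw => map_mem_weilClassesOf D.P D.ψ (D.ψ_comp_weilEndo m) hw
  have hfinj : Function.Injective f := (complexBetti_map_bijective_of_isIsogeny (D.isIsogeny_weilEndo m) (2 * 3)).1
  have hinj : Function.Injective (f.restrict hmaps) := fun a b hab => by
    apply Subtype.ext
    apply hfinj
    have := congrArg Subtype.val hab
    simpa [LinearMap.restrict_apply] using this
  have hsurj : Function.Surjective (f.restrict hmaps) := LinearMap.injective_iff_surjective.1 hinj
  obtain ⟨⟨w, hw⟩, e⟩ := hsurj ⟨v, hv⟩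
  refine ⟨w, hw, ?_⟩
  have := congrArg Subtype.val e
  simpa [LinearMap.restrict_apply] using this

/-- **… hence a class whose `u^*`-image lies in the Weil plane lies in the Weil plane** (`u^*` injective).
[cite: vanGeemen1994HodgeAV, 4.9 and §3.6] -/
theorem mem_weilClassesOf_of_map_weilEndo_mem (m : ℤ) {w : complexBetti D.P.X (2 * 3)}
    (h : complexBetti.map (D.weilEndo m).hom.hom.hom (2 * 3) w ∈ weilClassesOf D.P D.ψ 3 D.d) : w ∈ weilClassesOf D.P D.ψ 3 D.d := by
  obtain ⟨w₀, hw₀, e⟩ := D.exists_mem_weilClassesOf_map_weilEndo_eq m h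
  have : w₀ = w := (complexBetti_map_bijective_of_isIsogeny (D.isIsogeny_weilEndo m) (2 * 3)).1 e
  exact this ▸ hw₀

/-- **The negative half of `ℤ[φ_d]` on an eigenclass**: if the test endomorphism `G = x·𝟙 + 1·φ_d` (`x : ℕ`) acts on `c` by `(x + εs)⁶`,
`s = i√d`, `ε = ±1`, then `u = (−x)·𝟙 + φ_d` acts by `(−x + εs)⁶`: `u ≫ G = −(x² + d)·𝟙`, so `(x + εs)⁶·u^*c = (x² + d)⁶·c`, and
`(x² + d) = −(x + εs)(−x + εs)`. (The eigenclass predicates of `WeilClasses` only test `ℕ`-combinations `x·𝟙 + y·φ_d`.)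
[cite: vanGeemen1994HodgeAV, 4.9 and proof of Thm. 6.12] -/
theorem map_weilEndo_neg_eq_smul_of_test (x : ℕ) {ε : ℂ} (hε : ε = 1 ∨ ε = -1) {c : complexBetti D.P.X (2 * 3)}
    (hlam : complexBetti.map (x • 𝟙 D.P + (1 : ℕ) • D.ψ).hom.hom.hom (2 * 3) c =
      (((x : ℂ) + ε * (Complex.I * (Real.sqrt D.d : ℂ))) ^ (2 * 3)) • c) :
    complexBetti.map (D.weilEndo (-(x : ℤ))).hom.hom.hom (2 * 3) c =
      ((((-(x : ℤ) : ℤ) : ℂ) + ε * (Complex.I * (Real.sqrt D.d : ℂ))) ^ (2 * 3)) • c := by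
  set s : ℂ := Complex.I * (Real.sqrt D.d : ℂ) with hs_def
  have hs : s ^ 2 = -(D.d : ℂ) := I_mul_sqrt_sq D.d
  have hε2 : ε ^ 2 = 1 := by rcases hε with rfl | rfl <;> norm_num
  set lam : ℂ := ((x : ℂ) + ε * s) ^ (2 * 3) with hlam_def
  have hlam0 : lam ≠ 0 := intCast_add_I_mul_sqrt_pow_ne_zero D.d_pos' (x : ℤ) ε hε (2 * 3) |>.comp (by
    intro h; rw [Int.cast_natCast]; exact h)
  -- `u ≫ G = −(x² + d)·𝟙`
  have hFG : D.weilEndo (-(x : ℤ)) ≫ (x • 𝟙 D.P + (1 : ℕ) • D.ψ) = (-((x : ℤ) ^ 2 + (D.d : ℤ))) • 𝟙 D.P := by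
    have hG' : (x • 𝟙 D.P + (1 : ℕ) • D.ψ) = (x : ℤ) • 𝟙 D.P + D.ψ := by rw [← natCast_zsmul, one_nsmul]
    rw [weilEndo_def, hG']
    simp only [Preadditive.add_comp, Preadditive.comp_add, Preadditive.zsmul_comp, Preadditive.comp_zsmul, Category.id_comp,
      Category.comp_id, D.ψ_comp_ψ]
    module
  -- `(u ≫ G)^* c` two ways
  have h1 : complexBetti.map (D.weilEndo (-(x : ℤ)) ≫ (x • 𝟙 D.P + (1 : ℕ) • D.ψ)).hom.hom.hom (2 * 3) c =
      lam • complexBetti.map (D.weilEndo (-(x : ℤ))).hom.hom.hom (2 * 3) c := by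
    rw [complexBetti_map_comp_hom_apply, hlam, map_smul]
  have h2 : complexBetti.map (D.weilEndo (-(x : ℤ)) ≫ (x • 𝟙 D.P + (1 : ℕ) • D.ψ)).hom.hom.hom (2 * 3) c =
      ((((-((x : ℤ) ^ 2 + (D.d : ℤ))) : ℤ) : ℂ) ^ (2 * 3)) • c := by
    rw [hFG, complexBetti_map_zsmul_hom_apply_eq_pow_smul, complexBetti_map_id_hom_apply]
  -- the scalar identity `(−(x² + d))⁶ = (x + εs)⁶ (−x + εs)⁶`
  have hscal : ((((-((x : ℤ) ^ 2 + (D.d : ℤ))) : ℤ) : ℂ) ^ (2 * 3)) = lam * ((((-(x : ℤ) : ℤ) : ℂ) + ε * s) ^ (2 * 3)) := by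
    rw [hlam_def, ← mul_pow]
    push_cast
    congr 1
    linear_combination (-1 : ℂ) * hs + (-(s ^ 2)) * hε2
  have h3 : lam • complexBetti.map (D.weilEndo (-(x : ℤ))).hom.hom.hom (2 * 3) c =
      lam • (((((-(x : ℤ) : ℤ) : ℂ) + ε * s) ^ (2 * 3)) • c) := by
    rw [← h1, h2, hscal, smul_smul]
  exact smul_right_injective _ hlam0 h3

/-- **`u^* = (m + i√d)⁶` ON `E₊`** for `u = m + φ_d`, ALL `m : ℤ`: for `m ≥ 0` this is the defining eigen-condition of `weilClassesPlus` at the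
test endomorphism `m·𝟙 + 1·φ_d`; for `m < 0` by `map_weilEndo_neg_eq_smul_of_test`.
[cite: vanGeemen1994HodgeAV, 4.9 and proof of Thm. 6.12] [cite: Markman2025SecantWeil, §1.3] -/
theorem map_weilEndo_eq_smul_of_mem_weilClassesPlus (m : ℤ) {c : complexBetti D.P.X (2 * 3)} (hc : c ∈ weilClassesPlus D.P D.ψ 3 D.d) :
    complexBetti.map (D.weilEndo m).hom.hom.hom (2 * 3) c = (((m : ℂ) + Complex.I * (Real.sqrt D.d : ℂ)) ^ (2 * 3)) • c := by
  obtain ⟨x, rfl | rfl⟩ := Int.eq_nat_or_neg m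
  · -- `m = x ≥ 0`: the test endomorphism `x·𝟙 + 1·φ_d`
    have hu : D.weilEndo (x : ℤ) = x • 𝟙 D.P + (1 : ℕ) • D.ψ := by rw [weilEndo_def, natCast_zsmul, one_nsmul]
    have h := (mem_weilClassesPlus_iff.mp hc) x 1
    rw [Nat.cast_one, one_mul] at h
    rw [hu, Int.cast_natCast]
    exact h
  · have h := (mem_weilClassesPlus_iff.mp hc) x 1
    rw [Nat.cast_one, one_mul] at h
    have h' := D.map_weilEndo_neg_eq_smul_of_test x (ε := 1) (Or.inl rfl) (c := c) (by rw [one_mul]; exact h)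
    rw [one_mul] at h'
    exact h'

/-- **`u^* = (m − i√d)⁶` ON `E₋`**, all `m : ℤ` (same with the conjugate character). [cite: vanGeemen1994HodgeAV, 4.9 and proof of Thm. 6.12] -/
theorem map_weilEndo_eq_smul_of_mem_weilClassesMinus (m : ℤ) {c : complexBetti D.P.X (2 * 3)} (hc : c ∈ weilClassesMinus D.P D.ψ 3 D.d) :
    complexBetti.map (D.weilEndo m).hom.hom.hom (2 * 3) c = (((m : ℂ) - Complex.I * (Real.sqrt D.d : ℂ)) ^ (2 * 3)) • c := by
  obtain ⟨x, rfl | rfl⟩ := Int.eq_nat_or_neg m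
  · have hu : D.weilEndo (x : ℤ) = x • 𝟙 D.P + (1 : ℕ) • D.ψ := by rw [weilEndo_def, natCast_zsmul, one_nsmul]
    have h := (mem_weilClassesMinus_iff.mp hc) x 1
    rw [Nat.cast_one, one_mul] at h
    rw [hu, Int.cast_natCast]
    exact h
  · have h := (mem_weilClassesMinus_iff.mp hc) x 1
    rw [Nat.cast_one, one_mul] at h
    have h' := D.map_weilEndo_neg_eq_smul_of_test x (ε := -1) (Or.inr rfl) (c := c)
      (by rw [neg_one_mul, ← sub_eq_add_neg]; exact h)
    rw [neg_one_mul, ← sub_eq_add_neg] at h'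
    exact h'

/-- **A NON-ZERO RATIONAL Weil class has non-zero components on BOTH Weil lines**: `W = E₊ ⊕ E₋` with `conj E₊ = E₋`; a rational class is
real (`conj w = w`), so `w ∈ E₋` would give `w = conj w ∈ E₊ ⊓ E₋ = 0`. [cite: vanGeemen1994HodgeAV, proof of Lemma 5.2 (6)]
[cite: VoisinHodgeI2002, Cor. 6.12] -/
theorem weilComponents_ne_zero {w e₁ e₂ : complexBetti D.P.X (2 * 3)} (hwQ : IsRationalClass w) (hw0 : w ≠ 0)
    (h₁ : e₁ ∈ weilClassesPlus D.P D.ψ 3 D.d) (h₂ : e₂ ∈ weilClassesMinus D.P D.ψ 3 D.d) (hw : w = e₁ + e₂) : e₁ ≠ 0 ∧ e₂ ≠ 0 := by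
  have hdisj := disjoint_weilClassesPlus_weilClassesMinus D.P D.ψ (n := 3) (d := D.d) (by decide) D.d_pos'
  have hreal : conjClass (Motives.ComplexPoints D.P.X) (2 * 3) w = w := hwQ.conjClass_eq
  constructor
  · rintro rfl
    rw [zero_add] at hw
    subst hw
    have hplus : w ∈ weilClassesPlus D.P D.ψ 3 D.d := by rw [← hreal]; exact conjClass_mem_weilClassesPlus h₂
    exact hw0 ((Submodule.disjoint_def.1 hdisj) w hplus h₂)
  · rintro rfl
    rw [add_zero] at hw
    subst hw
    have hminus : w ∈ weilClassesMinus D.P D.ψ 3 D.d := by rw [← hreal]; exact conjClass_mem_weilClassesMinus h₁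
    exact hw0 ((Submodule.disjoint_def.1 hdisj) w h₁ hminus)

/-- **THE MOVED PAIR SPANS THE WEIL PLANE.** At a datum `D`, for `u = m + φ_d` off the degenerate directions (`m ≠ 0`, `3m² ≠ d`, `m² ≠ 3d`),
a NON-ZERO RATIONAL Weil class `w₁` and a class `w'` with `u^*w' = n·w₁`, `n ≠ 0` (the pull-backs to `J × Ĵ` of a served class `γ₁` and of
`γ' = ḡ_{u*}γ₁/…` with `ḡ_u^*γ' = #Ker ḡ_u·γ₁`): `w'` lies in the Weil plane, and EVERY Weil class is `x·w₁ + y·w'`. Proof: `w₁ = e₊ + e₋` with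
both components non-zero (real structure), `u^* = λ_± = (m ± i√d)⁶` on the LINES `E_±` (`dim E_± = 1`: `H• = ⋀•H¹`, `b₁ = 12`), so
`w' = (n/λ₊)e₊ + (n/λ₋)e₋` is a second direction because `λ₊ ≠ λ₋` (§1), and `{e₊, e₋}` spans `W`. THEOREM M (a)'s `W_ℚ(Y₄) = ℚγ₀ ⊕ ℚγ₁`
in kernel form. [cite: vanGeemen1994HodgeAV, 4.9, Lemma 5.2 (5)–(6) and proof of Thm. 6.12] [cite: MoonenZarhin1998WeilClasses, §1 (dim_K W_K = 1)]
[cite: Markman2025SecantWeil, §1.3 and Thm. 1.4.1 (item 4)] -/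
theorem mem_weilClassesOf_and_span_of_map_weilEndo_eq_smul {m : ℤ} (hm0 : m ≠ 0) (hm1 : 3 * m ^ 2 ≠ (D.d : ℤ)) (hm2 : m ^ 2 ≠ 3 * (D.d : ℤ))
    {w₁ w' : complexBetti D.P.X (2 * 3)} (hw₁ : w₁ ∈ weilClassesOf D.P D.ψ 3 D.d) (hw₁Q : IsRationalClass w₁) (hw₁0 : w₁ ≠ 0)
    {n : ℂ} (hn : n ≠ 0) (hu : complexBetti.map (D.weilEndo m).hom.hom.hom (2 * 3) w' = n • w₁) :
    w' ∈ weilClassesOf D.P D.ψ 3 D.d ∧ ∀ w ∈ weilClassesOf D.P D.ψ 3 D.d, ∃ x y : ℂ, w = x • w₁ + y • w' := by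
  have hd := D.d_pos'
  have hw' : w' ∈ weilClassesOf D.P D.ψ 3 D.d :=
    D.mem_weilClassesOf_of_map_weilEndo_mem m (by rw [hu]; exact Submodule.smul_mem _ _ hw₁)
  refine ⟨hw', fun w hw => ?_⟩
  -- components of `w₁` and `w'`
  obtain ⟨e₁, h₁, e₂, h₂, he⟩ := Submodule.mem_sup.1 hw₁
  obtain ⟨f₁, hf₁, f₂, hf₂, hf⟩ := Submodule.mem_sup.1 hw'
  obtain ⟨he₁0, he₂0⟩ := D.weilComponents_ne_zero hw₁Q hw₁0 h₁ h₂ he.symm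
  set lp : ℂ := ((m : ℂ) + Complex.I * (Real.sqrt D.d : ℂ)) ^ (2 * 3) with hlp
  set lm : ℂ := ((m : ℂ) - Complex.I * (Real.sqrt D.d : ℂ)) ^ (2 * 3) with hlm
  have hlp0 : lp ≠ 0 := by
    have := intCast_add_I_mul_sqrt_pow_ne_zero hd m 1 (Or.inl rfl) (2 * 3); rwa [one_mul] at this
  have hlm0 : lm ≠ 0 := by
    have := intCast_add_I_mul_sqrt_pow_ne_zero hd m (-1) (Or.inr rfl) (2 * 3); rwa [neg_one_mul, ← sub_eq_add_neg] at this
  have hne : lp ≠ lm := intCast_add_I_mul_sqrt_pow_six_ne hd hm0 hm1 hm2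
  -- `u^*w' = lp f₁ + lm f₂ = n e₁ + n e₂`, so `lp f₁ = n e₁`, `lm f₂ = n e₂`
  have hu' : lp • f₁ + lm • f₂ = n • e₁ + n • e₂ := by
    rw [← D.map_weilEndo_eq_smul_of_mem_weilClassesPlus m hf₁, ← D.map_weilEndo_eq_smul_of_mem_weilClassesMinus m hf₂, ← map_add, hf, hu,
      ← he, smul_add]
  have hdisj := disjoint_weilClassesPlus_weilClassesMinus D.P D.ψ (n := 3) (d := D.d) (by decide) hd
  have hcomp : lp • f₁ - n • e₁ = 0 := by
    have hin₁ : lp • f₁ - n • e₁ ∈ weilClassesPlus D.P D.ψ 3 D.d := Submodule.sub_mem _ (Submodule.smul_mem _ _ hf₁) (Submodule.smul_mem _ _ h₁)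
    have hin₂ : lp • f₁ - n • e₁ ∈ weilClassesMinus D.P D.ψ 3 D.d := by
      have e : lp • f₁ - n • e₁ = n • e₂ - lm • f₂ := by
        rw [sub_eq_sub_iff_add_eq_add, hu', add_comm]
      rw [e]
      exact Submodule.sub_mem _ (Submodule.smul_mem _ _ h₂) (Submodule.smul_mem _ _ hf₂)
    exact (Submodule.disjoint_def.1 hdisj) _ hin₁ hin₂
  have hf₁e : f₁ = (n * lp⁻¹) • e₁ := by
    have : lp • f₁ = n • e₁ := sub_eq_zero.1 hcomp
    calc f₁ = lp⁻¹ • (lp • f₁) := by rw [smul_smul, inv_mul_cancel₀ hlp0, one_smul]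
      _ = (n * lp⁻¹) • e₁ := by rw [this, smul_smul, mul_comm lp⁻¹ n]
  have hf₂e : f₂ = (n * lm⁻¹) • e₂ := by
    have : lm • f₂ = n • e₂ := by
      have := hu'
      rw [sub_eq_zero.1 hcomp] at this
      exact add_left_cancel this
    calc f₂ = lm⁻¹ • (lm • f₂) := by rw [smul_smul, inv_mul_cancel₀ hlm0, one_smul]
      _ = (n * lm⁻¹) • e₂ := by rw [this, smul_smul, mul_comm lm⁻¹ n]
  -- `w = a e₁ + b e₂` on the two LINES
  have hΛ := AbelianVariety.hasExteriorCohomologyH1_complexPoints D.P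
  obtain ⟨wp, hwp, wm, hwm, hww⟩ := Submodule.mem_sup.1 hw
  obtain ⟨a, ha⟩ := Submodule.mem_span_singleton.1
    (weilClassesPlus_le_span_singleton hΛ D.finrank_complexBetti_P_one hd D.ψ_comp_ψ_nsmul' h₁ he₁0 hwp)
  obtain ⟨b, hb⟩ := Submodule.mem_span_singleton.1
    (weilClassesMinus_le_span_singleton hΛ D.finrank_complexBetti_P_one hd D.ψ_comp_ψ_nsmul' h₂ he₂0 hwm)
  -- solve `x(e₁ + e₂) + y(μ₊ e₁ + μ₋ e₂) = a e₁ + b e₂`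
  set μp : ℂ := n * lp⁻¹ with hμp
  set μm : ℂ := n * lm⁻¹ with hμm
  have hμ : μp - μm ≠ 0 := by
    rw [hμp, hμm, ← mul_sub]
    refine mul_ne_zero hn (sub_ne_zero.2 fun e => hne ?_)
    have := congrArg (fun t => t⁻¹) e
    simpa using this
  refine ⟨a - (a - b) / (μp - μm) * μp, (a - b) / (μp - μm), ?_⟩
  have hx : a - (a - b) / (μp - μm) * μp + (a - b) / (μp - μm) * μp = a := by ring
  have hy : a - (a - b) / (μp - μm) * μp + (a - b) / (μp - μm) * μm = b := by
    field_simp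
    ring
  calc w = a • e₁ + b • e₂ := by rw [← hww, ← ha, ← hb]
    _ = (a - (a - b) / (μp - μm) * μp + (a - b) / (μp - μm) * μp) • e₁ +
          (a - (a - b) / (μp - μm) * μp + (a - b) / (μp - μm) * μm) • e₂ := by rw [hx, hy]
    _ = (a - (a - b) / (μp - μm) * μp) • w₁ + ((a - b) / (μp - μm)) • w' := by
        rw [← he, ← hf, hf₁e, hf₂e]
        module

end SecantQuotientDatum

end Summit.HodgeConjecture.HodgeConjecture.Ring2.SemiregularRepresentatives

end
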